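/-
Copyright (c) 2026 the pub-hodgecm-mathlib formalisation cell (harness21).  Prover seat hodgecm-mathlib-LH4-p05 (g3), req620 Track A «(D-RAM) FOUR-FRAME» squad
(unit U3_Laws, (R-18) «K-ABS-R := NI2 ⊕ KMS»; DEFS LEAF of the (KMS) road «MODULO κ-STAGE B», dealer LH4-plan (g11) WORD #20∕#21, RE-KEYED ON MULTIPLICITY per
LH4-p11 (g2)'s RULING 2026-09-04T00:53Z (R-21) and LH-ref2 (g10) BOX #8; plan `F0/P3c/LH4/LH4-p05/g3/PLAN-KMS-modKappaStageB.v1`).  2026-09-04.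
-/
import Summits.HodgeConjecture.HodgeConjecture.Theorems.F0P3cDyRamDiagonalStrataDefs   -- ★ p855793 ∕ ED. 3 p856283 (LH4-p11): `polarisationCosets`, `polarisationCount`; brings ★ TorusDefs (`fixedUnitStabilizer`, `stabiliserWeight`)
import Literature.NumberTheory.Automorphic.UnitaryThreeFourFrameDefs                   -- ★ (B-p04): `normSign` (the norm-class sign `ω`)
import HarnessLib

/-!
# Crux `H413`, line LH4 «(D-RAM) FOUR-FRAME» road — unit U3_Laws (iii), (KMS) ROAD «MODULO κ-STAGE B»: DEFS LEAF «THE κ-COUNT OF A LATTICE»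
# (four definitions + `rfl` ∕ `Iff.rfl` ties; no theorem content)

Cell `hodgecm-mathlib` (D-0151), FLOOR 0, crux item H413 = `stmt-HodgeConjecture-24833`, route of record `HCCMUnconditional`; squad F0∕P3c∕LH4 (req618∕req620); registered stub served:
`F0P3cDyRamFourFrameU3.stub_U3_kappaModelSum` (KMS; tree `Cruxes/H413/Lines/F0_P3c_DyRamFourFrame_U3_Laws.lean` ED. 7 :407–:429), through which `stub_U3_kappaAbsLawR` is PAID by
composition (★ p855529).  DEFINITIONS ONLY (no instance, no notation, no `sorry`, no theorem asserting anything about `U(3)`); lane `--supports stmt-HodgeConjecture-24833`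
(count-neutral).  Precedents: ★ DEFS leaves `F0P3cDyRamDiagonalTorusDefs` (p11), `F0P3cDyRamDiagonalStrataDefs` (p10∕p11).

WHY A DEFS LEAF.  The (KMS) sentence is the (MS) sentence with the eight sign classes `e ∈ (ℤ∕2)³` WEIGHTED by the character `χ⁰_i(e) = Π_{j ≠ i} sgn(e j)` of the U3 text
(`sgn b = −1` if `b` else `1`).  The re-keyed Stage A of (MS) ((R-21): ★ (O2a), (O2b)-MULT, (O2c)-MULT — p04∕p14∕p11) turns `Σ_e #{M : M type-tv for diag(c^{e}), T·M = M}` into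
`8 · Σᶠ_{M₀ ∈ 𝓛₀(T)} n_tv(M₀) · stabiliserWeight σ M₀`, `n_tv = polarisationCount` = the NUMBER of `S_F(M₀)`-cosets of type-tv polarisations (`1` on normalised lattices at `tv = 0`,
★ `fibre_isCoset_zero`; `q` on the glued type-2 strata with `ρ` even, LH4-p09 (g2)).  The κ-twist of the same route (this seat, files `…DiagonalKappaOrbit*`) turns
`Σ_e χ⁰_i(e) · #{…}` into `8 · Σᶠ_{M₀ ∈ 𝓛₀(T)} m_i(M₀) · stabiliserWeight σ M₀` with ONE new per-lattice invariant, the SIGNED κ-COUNT `m_i(M₀) = kappaCount σ ϖ tv i M₀ ∈ ℤ`: the sum,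
over the `S_F(M₀)`-cosets `C = D·S_F(M₀)` of type-tv polarisations, of the coset's κ-SIGN `cosetKappa σ i C ∈ {−1, 0, 1}` — the constant value of `χ_i(D') = Π_{j ≠ i} ω(D'_j)`
(`ω = normSign σ`) on `C` if `χ_i` is constant there (⟺ `χ_i ≡ 1` on `S_F(M₀)`, under (NI2)), else `0`.  So `|m_i| ≤ n_tv`, `m_i = χ_i(D₁)·[χ_i|S_F ≡ 1]` when there is one coset
(every normalised lattice at `tv = 0`), and at `tv = 2` on a `q`-coset stratum `m_i = Σ_{r} χ_i(D_r)·[χ_i|S_F ≡ 1]` (all `q` cosets of one sign: `±q`; split signs: the signed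
difference).  The κ-Stage-B bricks («Σᶠ over a stratum of `(kappaCount : ℚ) · stabiliserWeight` = closed form») and the (KMS) reduction head `…KappaModelSumOfKappaStageB` quote
these names; Theorems files declare no `def`.  Everything is CHOICE-FREE (`if`-chains on `Prop`s, `finsum` over ★ `polarisationCosets`); the evaluation lemmas
(`cosetKappa (D·S_F) = if χ_i|S_F ≡ 1 then χ_i(D) else 0` under (NI2), `kappaCount = cosetKappa (D₁·S_F)` under the one-coset property) are THEOREMS of the sequel
`…DiagonalKappaCountEval`, not docstring facts.

CONTENTS (`N = 3`; `K : Type` with `Valued K ℤᵐ⁰` — `Type`, not `Type*`, because ★ `normSign` is stated there).  §1 `signChar i e` — the U3 text's table `χ⁰_i(e)` (token for token).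
§2 `chiVec σ i D` — `χ_i(D) = Π_{j ≠ i} ω(D_j)` as the same table on `ω`-values.  §3 `cosetKappa σ i C` (the κ-sign of a set of forms) and `kappaCount σ ϖ tv i M :=
Σᶠ_{C ∈ polarisationCosets σ ϖ tv M} cosetKappa σ i C`.  §4 `rfl` ∕ `Iff.rfl` ties and the two vanishing identities the Stage A files use.
HONEST LABEL.  Count-neutral vehicle; defines, asserts nothing; (KMS) stays a PROVER TARGET (empirical census law in diagonal-model currency); `HC_CM` is proved only modulo the 7 printed
citations (2 remaining named inputs: hLiu418 = `stmt-HodgeConjecture-24832`, h413 = `stmt-HodgeConjecture-24833`) until rung 0 closes.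

## References
* [Kottwitz1986BaseChangeUnits] R. E. Kottwitz, *Base change for unit elements of Hecke algebras*, Compositio Math. 60 (1986), §1 pp. 240–241 (κ-orbital integrals of units as
  signed lattice counts modulo the torus).
* [Rogawski1990] J. D. Rogawski, *Automorphic Representations of Unitary Groups in Three Variables*, Ann. of Math. Stud. 123 (1990), §4.9 Prop. 4.9.1 (a) p. 55; §4.10 p. 58
  (the κ-signs `κ(δ)` on the classes inside a stable class).
* [LanglandsShelstad1987] R. P. Langlands, D. Shelstad, *On the definition of transfer factors*, Math. Ann. 278 (1987), §3 (κ as a character of `H¹(F, T)`).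
-/

set_option autoImplicit false

noncomputable section

namespace Summit.HodgeConjecture.HodgeConjecture.Cruxes.H413.F0P3cDyRamDiagonalKappaCountDefs

open Matrix
open Literature.NumberTheory.Automorphic Literature.NumberTheory.Automorphic.HermitianLattice
open Literature.NumberTheory.Automorphic.UnitaryLatticeTree Literature.NumberTheory.Automorphic.UnitaryThreeFourFrame
open Summit.HodgeConjecture.HodgeConjecture.Cruxes.H413.F0P3cDyRamDiagonalTorusDefs
open Summit.HodgeConjecture.HodgeConjecture.Cruxes.H413.F0P3cDyRamDiagonalStrataDefs
open scoped Valued WithZero Matrix MatrixGroups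

variable {K : Type} [Field K]

/-! ## §1  The sign character `χ⁰_i` of the U3 text -/

/-- **`χ⁰_i(e)`** — THE U3 TEXT'S SIGN TABLE, token for token: `χ⁰_0(e) = sgn(e 1)·sgn(e 2)`, `χ⁰_1(e) = sgn(e 0)·sgn(e 2)`, `χ⁰_2(e) = sgn(e 0)·sgn(e 1)` with `sgn b = −1` if `b`
else `1` — the three non-trivial characters of `(ℤ∕2)³` trivial on the diagonal class `(1,1,1)`, i.e. the κ of [LanglandsShelstad1987, §3] for the three endoscopic slots.
[cite: Rogawski1990, §4.10 p. 58] [cite: LanglandsShelstad1987, §3] -/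
def signChar (i : Fin 3) (e : Fin 3 → Bool) : ℤ :=
  (![(if e 1 then -1 else 1) * (if e 2 then -1 else 1),
     (if e 0 then -1 else 1) * (if e 2 then -1 else 1),
     (if e 0 then -1 else 1) * (if e 1 then -1 else 1)] : Fin 3 → ℤ) i

/-! ## §2  The κ-character of a vector of forms -/

/-- **`χ_i(D) = Π_{j ≠ i} ω(D_j)`** (`ω = normSign σ`, the norm-class sign H1 of ★ `UnitaryThreeFourFrameDefs`): the same table as `signChar` on the values `ω(D_j) ∈ {±1}` — for
`D = d_e` (`d_e j = c` if `e j` else `1`, `c` a non-norm) it IS `χ⁰_i(e)`. [cite: Rogawski1990, §4.10 p. 58] [cite: LanglandsShelstad1987, §3] -/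
def chiVec (σ : K →+* K) (i : Fin 3) (D : Fin 3 → K) : ℤ :=
  (![normSign σ (D 1) * normSign σ (D 2), normSign σ (D 0) * normSign σ (D 2), normSign σ (D 0) * normSign σ (D 1)] : Fin 3 → ℤ) i

/-! ## §3  The κ-sign of a coset of forms and the signed κ-count of a lattice -/

open Classical in
/-- **THE κ-SIGN OF A SET OF FORMS**: `cosetKappa σ i C = 1` if `χ_i ≡ 1` on `C`, `−1` if `χ_i ≡ −1` on `C`, `0` otherwise (`C` non-constant or — harmlessly — empty: then `1`).
For an `S_F(M)`-coset `C = D·S_F(M)` this is `χ_i(D)·[χ_i ≡ 1 on S_F(M)]` (sequel `…DiagonalKappaCountEval`, under (NI2)). [cite: Kottwitz1986BaseChangeUnits, §1 pp. 240–241]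
[cite: LanglandsShelstad1987, §3] -/
def cosetKappa (σ : K →+* K) (i : Fin 3) (C : Set (Fin 3 → K)) : ℤ :=
  if (∀ D ∈ C, chiVec σ i D = 1) then 1 else if (∀ D ∈ C, chiVec σ i D = -1) then -1 else 0

section WithValuation

variable [Valued K ℤᵐ⁰]

/-- **THE SIGNED κ-COUNT `m_i(M)` at vertex type `tv`** — the sum of the κ-signs of the `S_F(M)`-cosets of type-`tv` polarisations of `M`:
`kappaCount σ ϖ tv i M = Σᶠ_{C ∈ polarisationCosets σ ϖ tv M} cosetKappa σ i C ∈ ℤ` (★ `polarisationCosets`, LH4-p11 ED. 3; `|m_i| ≤ polarisationCount`; `0` off the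
polarisable set).  It is the multiplicity with which the unit-torus orbit of `M` enters the κ-weighted eight-class vertex count: `Σ_e χ⁰_i(e)·C_tv(e) = 8·Σᶠ_{M₀ ∈ 𝓛₀(T)}
m_i(M₀)·stabiliserWeight σ M₀` (this seat's `…DiagonalKappaOrbitCount`). [cite: Kottwitz1986BaseChangeUnits, §1 pp. 240–241] [cite: Rogawski1990, §4.9 Prop. 4.9.1 (a) p. 55]
[cite: LanglandsShelstad1987, §3] -/
def kappaCount (σ : K →+* K) (ϖ : K) (tv : ℕ) (i : Fin 3) (M : Submodule 𝒪[K] (Fin 3 → K)) : ℤ :=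
  ∑ᶠ C ∈ polarisationCosets σ ϖ tv M, cosetKappa σ i C

end WithValuation

/-! ## §4  Ties -/

/-- `signChar` IS the inline table of the U3 text (`rfl`). [cite: Rogawski1990, §4.10 p. 58] -/
theorem signChar_eq (i : Fin 3) (e : Fin 3 → Bool) :
    signChar i e = (![(if e 1 then -1 else 1) * (if e 2 then -1 else 1),
      (if e 0 then -1 else 1) * (if e 2 then -1 else 1),
      (if e 0 then -1 else 1) * (if e 1 then -1 else 1)] : Fin 3 → ℤ) i := rfl

/-- Unfolding `chiVec`, `rfl`. [cite: Rogawski1990, §4.10 p. 58] -/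
theorem chiVec_eq (σ : K →+* K) (i : Fin 3) (D : Fin 3 → K) :
    chiVec σ i D = (![normSign σ (D 1) * normSign σ (D 2), normSign σ (D 0) * normSign σ (D 2), normSign σ (D 0) * normSign σ (D 1)] : Fin 3 → ℤ) i := rfl

open Classical in
/-- Unfolding `cosetKappa`, `rfl`. [cite: LanglandsShelstad1987, §3] -/
theorem cosetKappa_eq (σ : K →+* K) (i : Fin 3) (C : Set (Fin 3 → K)) :
    cosetKappa σ i C = if (∀ D ∈ C, chiVec σ i D = 1) then 1 else if (∀ D ∈ C, chiVec σ i D = -1) then -1 else 0 := rfl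

/-- **`cosetKappa` of a set on which `χ_i ≡ 1` is `1`.** [cite: LanglandsShelstad1987, §3] -/
theorem cosetKappa_of_forall_eq_one (σ : K →+* K) (i : Fin 3) {C : Set (Fin 3 → K)} (h : ∀ D ∈ C, chiVec σ i D = 1) : cosetKappa σ i C = 1 := by
  rw [cosetKappa_eq, if_pos h]

/-- **`cosetKappa` of a non-empty set on which `χ_i ≡ −1` is `−1`.** [cite: LanglandsShelstad1987, §3] -/
theorem cosetKappa_of_forall_eq_neg_one (σ : K →+* K) (i : Fin 3) {C : Set (Fin 3 → K)} (hne : C.Nonempty) (h : ∀ D ∈ C, chiVec σ i D = -1) :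
    cosetKappa σ i C = -1 := by
  obtain ⟨D, hD⟩ := hne
  have h1 : ¬ ∀ D ∈ C, chiVec σ i D = 1 := fun h' => by have := h D hD; rw [h' D hD] at this; exact absurd this (by decide)
  rw [cosetKappa_eq, if_neg h1, if_pos h]

/-- **`cosetKappa` of a set carrying both signs is `0`.** [cite: LanglandsShelstad1987, §3] -/
theorem cosetKappa_of_exists_exists (σ : K →+* K) (i : Fin 3) {C : Set (Fin 3 → K)}
    (h₁ : ∃ D ∈ C, chiVec σ i D ≠ 1) (h₂ : ∃ D ∈ C, chiVec σ i D ≠ -1) : cosetKappa σ i C = 0 := by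
  obtain ⟨D₁, hD₁, h₁⟩ := h₁
  obtain ⟨D₂, hD₂, h₂⟩ := h₂
  rw [cosetKappa_eq, if_neg (fun h => h₁ (h D₁ hD₁)), if_neg (fun h => h₂ (h D₂ hD₂))]

section WithValuation

variable [Valued K ℤᵐ⁰]

/-- Unfolding `kappaCount`, `rfl`. [cite: Kottwitz1986BaseChangeUnits, §1 pp. 240–241] -/
theorem kappaCount_eq (σ : K →+* K) (ϖ : K) (tv : ℕ) (i : Fin 3) (M : Submodule 𝒪[K] (Fin 3 → K)) :
    kappaCount σ ϖ tv i M = ∑ᶠ C ∈ polarisationCosets σ ϖ tv M, cosetKappa σ i C := rfl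

/-- **Off the polarisable set the κ-count vanishes** (`polarisationCosets = ∅`). [cite: Kottwitz1986BaseChangeUnits, §1 pp. 240–241] -/
theorem kappaCount_eq_zero_of_not_exists (σ : K →+* K) (ϖ : K) (tv : ℕ) (i : Fin 3) (M : Submodule 𝒪[K] (Fin 3 → K))
    (h : ¬ ∃ D : Fin 3 → K, (∀ j, σ (D j) = D j ∧ D j ≠ 0) ∧ IsVertexLattice σ ϖ (Matrix.diagonal D) tv M) :
    kappaCount σ ϖ tv i M = 0 := by
  have he : polarisationCosets σ ϖ tv M = ∅ :=
    Set.eq_empty_of_forall_notMem fun C ⟨D, hD, _⟩ => h ⟨D, hD.1, hD.2⟩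
  rw [kappaCount, he, finsum_mem_empty]

/-- At `tv = 0`: not ★-dualisable ⟹ `kappaCount σ ϖ 0 i M = 0`. [cite: Kottwitz1986BaseChangeUnits, §1 pp. 240–241] -/
theorem kappaCount_zero_eq_zero_of_not_isDualisableLattice (σ : K →+* K) (ϖ : K) (i : Fin 3) (M : Submodule 𝒪[K] (Fin 3 → K))
    (h : ¬ IsDualisableLattice σ ϖ M) : kappaCount σ ϖ 0 i M = 0 :=
  kappaCount_eq_zero_of_not_exists σ ϖ 0 i M h

/-- At `tv = 2`: not ★-type-2-polarisable ⟹ `kappaCount σ ϖ 2 i M = 0`. [cite: Kottwitz1986BaseChangeUnits, §1 pp. 240–241] -/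
theorem kappaCount_two_eq_zero_of_not_isTypeTwoPolarisable (σ : K →+* K) (ϖ : K) (i : Fin 3) (M : Submodule 𝒪[K] (Fin 3 → K))
    (h : ¬ IsTypeTwoPolarisable σ ϖ M) : kappaCount σ ϖ 2 i M = 0 :=
  kappaCount_eq_zero_of_not_exists σ ϖ 2 i M h

end WithValuation

end Summit.HodgeConjecture.HodgeConjecture.Cruxes.H413.F0P3cDyRamDiagonalKappaCountDefs

end
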